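import Summits.QuantumFields.BalabanUV.Beta.D1BFx.ShellRoadEnd

/-!
# `BalabanUV.Beta.D1BFx.SbpShellAlgebra` — road «BF-x» for binder row D1: THE SUMMATION-BY-PARTS SCALAR WALL, PART 1 OF 4 —
# the `D·Q + P` form of the (1.22) integrand, pointwise sizes on shells (shifts absorbed), lattice-sum plumbing and Abel summation on `ℤ⁴`

HONEST DEPENDENCY (page 1, mandatory): continuum YM on T⁴ ⇐ BetaPertH ∧ nine spine estimates (0/9 proved); BetaPertH ⇐ (D1) ∧ (D4) ∧ CAP+tail;
G-an2-4 gates asym, D1 and NE2/3/4.  HONEST FRAMING (cell contract, verbatim): «discharging `BetaPertH` makes Bałaban's UV stability UNCONDITIONAL —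
a real constructive-QFT result; it is NOT the continuum limit and NOT the Clay problem.»  THIS MODULE DISCHARGES NOTHING of the wall by itself:
[folklore] analysis about ARBITRARY functions `G, g : ℤ⁴ → ℝ` under displayed rows; no `def`, no `Prop` mirror, no cited fact, 0 sorry.
0 wall binders instantiated; NOT D1, NOT `BetaPertH`, NOT continuum, NOT Clay.

ABSOLUTE RULE (cell charter, verbatim): «No internally-minted statement may enter as a cited fact. Every hypothesis is either kernel-proved in this
package or a verbatim quotation of a PUBLISHED theorem with page reference. The manuscript(s) under audit are NOT citable for their own disputed steps —
they are the thing under adjudication; programme-internal (2001/route/tribunal) claims are never citable.»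

WHY (owner gen 13; `CENSUS-K6a-v1.md` §v4.21 «legs h2s∕d2s OPEN»).  The shell rows `h2s`∕`d2s` displayed by every END of road BF-x (leaf-07's C3-SHELL wall
`ShellRoadEnd.d1Drift_of_strongRoad_shell`) are NOT needed by the wall: the mixed second difference of the correction `E = G − gFree` enters the (1.22)
integrand LINEARLY (`stK G w = w_μw_ν·(D_{μν}G·Q_G + P_G)`, `stK_decomp`), and ONE Abel summation in the `ν`-direction over all of `ℤ⁴`
(`tsum_mul_shift_sub`, no boundary terms) moves it onto the weight, leaving first differences only.  This part supplies the algebra (§1), the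
pointwise window∕exterior sizes of `G` and of its first differences near a shell (§2), and the plumbing (§3): all finite sums of a nonnegative
lattice function from window shell sums + exterior pointwise tails (`sum_le_of_shellBounds`, over `ShellWindowInterface.window_sub_le_of_shellRows`
and `WindowInterface.tail_sum_le_exp`), summability and the full-sum bound, `x^k e^{−ax} ≤ k!∕a^k`, and the shift identity on `tsum`.
The END is PART 4 `SbpScalarEnd.d1Drift_of_strongRoad_sbp`.
Unit `b2b-balaban-beta-d1-p2` (gen 13), road «BF-x» OWNER; `LEAVES-BFx.md` row «C3-SBP»; CENSUS-K6a §v4.22.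
-/

noncomputable section

open Finset Filter Topology
open scoped BigOperators
open Literature.Probability.LatticeModels (annulus box)
open Literature.MathematicalPhysics.QuantumFieldTheory.Balaban1983to89
open Literature.MathematicalPhysics.QuantumFieldTheory.Balaban1983to89.Beta
open B12Sec2to5 (l1 l1_nonneg)
open DyadicShell (Pt toReal supNorm mem_annulus_iff ne_zero_of_mem_annulus supNorm_eq_of_mem_sphere supNorm_eq_zero_iff natAbs_le_supNorm
  toReal_apply)
open BubbleTransfer (Leg unitVec)
open TwoPowerLegs (free freeMixedLeg supNorm_sub_le_supNorm_add supNorm_unitVec abs_latticeGreen_half_le freeMixedLeg_a free_g)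
open GhostTable (gFree mixedDiffFun fwdDiffFun cellForm freeMixedLeg_f)
open SquareTable (stK stK_eq_closedForm mixedDiffFun_sq)
open WindowIdentification (fullSum psum)
open ExpKernelCalculus (summable_exp_shift')

namespace Summit.QuantumFields.BalabanUV.Beta.D1BFx.SbpShellAlgebra

variable {μ ν : Fin 4}

/-! ## §1 Algebra: the `D·Q + P` form of the (1.22) integrand, linearity of the mixed difference, the weight identities -/

/-- [folklore] **THE `D·Q + P` FORM**: `stK μ ν N G w = w_μ w_ν·(D_{μν}G(w)·Q_G(w) + P_G(w))` with `Q_G(w) = 8N²(G(w+e_ν+e_μ) + G(w+e_ν)) − 4N²G(w)` and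
`P_G(w) = 8N²·F_μG(w)·(F_νG(w+e_μ) + F_νG(w)) + 4N²·F_μG(w)·F_νG(w)` (`stK_eq_closedForm`, the square-cell identity `mixedDiffFun_sq`, `cellForm`). -/
theorem stK_decomp (N : ℝ) (G : Pt → ℝ) (w : Pt) :
    stK μ ν N G w = toReal w μ * toReal w ν *
      (mixedDiffFun G (unitVec μ) (unitVec ν) w * (8 * N ^ 2 * (G (w + unitVec ν + unitVec μ) + G (w + unitVec ν)) - 4 * N ^ 2 * G w) +
        (8 * N ^ 2 * (fwdDiffFun G (unitVec μ) w * (fwdDiffFun G (unitVec ν) (w + unitVec μ) + fwdDiffFun G (unitVec ν) w)) +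
          4 * N ^ 2 * (fwdDiffFun G (unitVec μ) w * fwdDiffFun G (unitVec ν) w))) := by
  rw [stK_eq_closedForm, mixedDiffFun_sq, cellForm]
  ring

/-- [folklore] The mixed difference is additive under `G = g + (G − g)`. -/
theorem mixedDiffFun_split (G g : Pt → ℝ) (e e' w : Pt) :
    mixedDiffFun G e e' w = mixedDiffFun g e e' w + mixedDiffFun (fun v => G v - g v) e e' w := by
  simp only [mixedDiffFun]
  ring

/-- [folklore] The forward difference is additive under `G = g + (G − g)`. -/
theorem fwdDiffFun_split (G g : Pt → ℝ) (e w : Pt) :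
    fwdDiffFun G e w = fwdDiffFun g e w + fwdDiffFun (fun v => G v - g v) e w := by
  simp only [fwdDiffFun]
  ring

/-- [folklore] **THE MIXED DIFFERENCE IS THE `ν`-DIFFERENCE OF THE `μ`-DIFFERENCE**: `D_{μν}E(w) = ψ(w + e_ν) − ψ(w)`, `ψ := F_μ E`. -/
theorem mixedDiffFun_eq_fwd_sub (E : Pt → ℝ) (w : Pt) :
    mixedDiffFun E (unitVec μ) (unitVec ν) w = fwdDiffFun E (unitVec μ) (w + unitVec ν) - fwdDiffFun E (unitVec μ) w := by
  simp only [mixedDiffFun, fwdDiffFun]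
  ring

/-- [folklore] `(w + e_ρ)_i = w_i + (e_ρ)_i` in real coordinates. -/
theorem toReal_add_unitVec (w : Pt) (ρ i : Fin 4) : toReal (w + unitVec ρ) i = toReal w i + toReal (unitVec ρ) i := by
  simp [toReal, unitVec]

/-- [folklore] `(e_ρ)_ρ = 1`. -/
theorem toReal_unitVec_self (ρ : Fin 4) : toReal (unitVec ρ) ρ = 1 := by
  simp [toReal, unitVec]

/-- [folklore] `(e_ρ)_i = 0` for `i ≠ ρ`. -/
theorem toReal_unitVec_ne {ρ i : Fin 4} (h : i ≠ ρ) : toReal (unitVec ρ) i = 0 := by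
  simp [toReal, unitVec, h]

/-- [folklore] `(w − e_ν)_μ = w_μ` for `μ ≠ ν`. -/
theorem toReal_sub_unitVec_ne (hμν : μ ≠ ν) (w : Pt) : toReal (w - unitVec ν) μ = toReal w μ := by
  simp [toReal, unitVec, hμν]

/-- [folklore] `(w − e_ν)_ν = w_ν − 1`. -/
theorem toReal_sub_unitVec_self (w : Pt) (ν : Fin 4) : toReal (w - unitVec ν) ν = toReal w ν - 1 := by
  simp [toReal, unitVec]

/-- [folklore] `|w_i| ≤ ‖w‖∞`. -/
theorem abs_toReal_le (w : Pt) (i : Fin 4) : |toReal w i| ≤ (supNorm w : ℝ) := by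
  rw [toReal_apply, ← Int.cast_abs, ← Nat.cast_natAbs]
  exact_mod_cast natAbs_le_supNorm w i

/-- [folklore] The (1.22) weight vanishes at the origin. -/
theorem toReal_zero (i : Fin 4) : toReal (0 : Pt) i = 0 := by simp [toReal]


/-! ## §2 Pointwise sizes on a shell (shifts `‖s‖∞ ≤ 1` absorbed): window forms (free-leg decay + `h`-rows) and exterior forms (`d`-rows) -/

section Pointwise

variable {G g : Pt → ℝ} {U0 C2 C3 e0 e1 A0 A1 c : ℝ} {r : ℕ} {w s : Pt}

/-- [folklore] On the shell `‖w‖∞ = r + 1`, `r ≥ 1`, a shift by `‖s‖∞ ≤ 1` stays at norm `≥ r` and off the origin. -/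
theorem shift_ge (hr : 1 ≤ r) (hw : w ∈ annulus 4 r (r + 1)) (hs : (supNorm s : ℝ) ≤ 1) :
    (r : ℝ) ≤ supNorm (w + s) ∧ w + s ≠ 0 := by
  have hsup : (supNorm w : ℝ) = (r : ℝ) + 1 := by rw [supNorm_eq_of_mem_sphere hw]; push_cast; ring
  have hr1 : (1 : ℝ) ≤ (r : ℝ) := by exact_mod_cast hr
  have h := supNorm_sub_le_supNorm_add w s
  have hge : (r : ℝ) ≤ supNorm (w + s) := by linarith
  refine ⟨hge, fun h0 => ?_⟩
  rw [h0] at hge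
  simp at hge
  linarith

/-- [folklore] `1/‖w+s‖^k ≤ 2^k/(r+1)^k` on the shell `r + 1`, `r ≥ 1`, `‖s‖∞ ≤ 1`. -/
theorem inv_pow_shift_le (hr : 1 ≤ r) (hw : w ∈ annulus 4 r (r + 1)) (hs : (supNorm s : ℝ) ≤ 1) {X : ℝ} (hX : 0 ≤ X) (k : ℕ) :
    X / (supNorm (w + s) : ℝ) ^ k ≤ X * 2 ^ k / ((r : ℝ) + 1) ^ k := by
  have hr1 : (1 : ℝ) ≤ (r : ℝ) := by exact_mod_cast hr
  have hge := (shift_ge hr hw hs).1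
  have hr0 : (0 : ℝ) < r := by linarith
  calc X / (supNorm (w + s) : ℝ) ^ k ≤ X / (r : ℝ) ^ k := by
        apply div_le_div_of_nonneg_left hX (by positivity)
        exact pow_le_pow_left₀ hr0.le hge k
    _ ≤ X * 2 ^ k / ((r : ℝ) + 1) ^ k := SquareTable.pow_shift_le k hX hr1

/-- [folklore] `e^{−c‖w+s‖} ≤ e^{c}·e^{−c(r+1)}` on the shell `r + 1`, `r ≥ 1`, `‖s‖∞ ≤ 1`, `c ≥ 0`. -/
theorem exp_shift_le (hr : 1 ≤ r) (hw : w ∈ annulus 4 r (r + 1)) (hs : (supNorm s : ℝ) ≤ 1) (hc : 0 ≤ c) :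
    Real.exp (-c * supNorm (w + s)) ≤ Real.exp c * Real.exp (-c * ((r : ℝ) + 1)) := by
  have hge := (shift_ge hr hw hs).1
  rw [← Real.exp_add]
  exact Real.exp_le_exp.mpr (by nlinarith)

/-- [folklore] **WINDOW SIZE OF `G` NEAR THE SHELL**: with `|g| ≤ U₀` everywhere, `|g(v)| ≤ C₂/‖v‖∞²` off the origin and `|G − g| ≤ e₀` everywhere, for
`‖w‖∞ = r + 1` (any `r`) and `‖s‖∞ ≤ 1`: `|G(w+s)| ≤ 4(U₀ + C₂)/(r+1)² + e₀`. -/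
theorem abs_G_shift_le_window (hU0 : 0 ≤ U0) (hC2 : 0 ≤ C2) (hgU : ∀ v, |g v| ≤ U0) (hg2 : ∀ v : Pt, v ≠ 0 → |g v| ≤ C2 / (supNorm v : ℝ) ^ 2)
    (h0 : ∀ v, |G v - g v| ≤ e0) (hw : w ∈ annulus 4 r (r + 1)) (hs : (supNorm s : ℝ) ≤ 1) :
    |G (w + s)| ≤ 4 * (U0 + C2) / ((r : ℝ) + 1) ^ 2 + e0 := by
  have hsplit : |G (w + s)| ≤ |g (w + s)| + e0 := by
    have h := h0 (w + s)
    have : |G (w + s)| ≤ |g (w + s)| + |G (w + s) - g (w + s)| := by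
      calc |G (w + s)| = |g (w + s) + (G (w + s) - g (w + s))| := by ring_nf
        _ ≤ |g (w + s)| + |G (w + s) - g (w + s)| := abs_add_le _ _
    linarith
  have hg : |g (w + s)| ≤ 4 * (U0 + C2) / ((r : ℝ) + 1) ^ 2 := by
    rcases Nat.eq_zero_or_pos r with hr0 | hr1
    · subst hr0
      have := hgU (w + s)
      simp only [Nat.cast_zero, zero_add, one_pow, div_one]
      linarith
    · have h2 := (hg2 _ (shift_ge hr1 hw hs).2).trans (inv_pow_shift_le hr1 hw hs hC2 2)
      have h3 : C2 * 2 ^ 2 / ((r : ℝ) + 1) ^ 2 ≤ 4 * (U0 + C2) / ((r : ℝ) + 1) ^ 2 :=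
        div_le_div_of_nonneg_right (by nlinarith) (by positivity)
      exact h2.trans h3
  linarith

/-- [folklore] **WINDOW SIZE OF A FIRST DIFFERENCE OF `G` NEAR THE SHELL**: with `|g| ≤ U₀`, `|F_ρ g(v)| ≤ C₃/‖v‖∞³` off the origin and
`|F_ρ(G − g)| ≤ e₁` everywhere: `|G(w+s+e_ρ) − G(w+s)| ≤ 8(2U₀ + C₃)/(r+1)³ + e₁`. -/
theorem abs_dG_shift_le_window (hU0 : 0 ≤ U0) (hC3 : 0 ≤ C3) (hgU : ∀ v, |g v| ≤ U0)
    (hg3 : ∀ v : Pt, v ≠ 0 → ∀ ρ : Fin 4, |g (v + unitVec ρ) - g v| ≤ C3 / (supNorm v : ℝ) ^ 3)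
    (h1 : ∀ v (ρ : Fin 4), |(G (v + unitVec ρ) - g (v + unitVec ρ)) - (G v - g v)| ≤ e1)
    (hw : w ∈ annulus 4 r (r + 1)) (hs : (supNorm s : ℝ) ≤ 1) (ρ : Fin 4) :
    |G (w + s + unitVec ρ) - G (w + s)| ≤ 8 * (2 * U0 + C3) / ((r : ℝ) + 1) ^ 3 + e1 := by
  have hsplit : |G (w + s + unitVec ρ) - G (w + s)| ≤ |g (w + s + unitVec ρ) - g (w + s)| + e1 := by
    have h := h1 (w + s) ρ
    have : |G (w + s + unitVec ρ) - G (w + s)| ≤ |g (w + s + unitVec ρ) - g (w + s)| +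
        |(G (w + s + unitVec ρ) - g (w + s + unitVec ρ)) - (G (w + s) - g (w + s))| := by
      calc |G (w + s + unitVec ρ) - G (w + s)|
          = |(g (w + s + unitVec ρ) - g (w + s)) + ((G (w + s + unitVec ρ) - g (w + s + unitVec ρ)) - (G (w + s) - g (w + s)))| := by
            ring_nf
        _ ≤ _ := abs_add_le _ _
    linarith
  have hg : |g (w + s + unitVec ρ) - g (w + s)| ≤ 8 * (2 * U0 + C3) / ((r : ℝ) + 1) ^ 3 := by
    rcases Nat.eq_zero_or_pos r with hr0 | hr1
    · subst hr0
      have ha := hgU (w + s + unitVec ρ)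
      have hb := hgU (w + s)
      have : |g (w + s + unitVec ρ) - g (w + s)| ≤ U0 + U0 := (abs_sub _ _).trans (add_le_add ha hb)
      simp only [Nat.cast_zero, zero_add, one_pow, div_one]
      linarith
    · have h2 := (hg3 _ (shift_ge hr1 hw hs).2 ρ).trans (inv_pow_shift_le hr1 hw hs hC3 3)
      have h3 : C3 * 2 ^ 3 / ((r : ℝ) + 1) ^ 3 ≤ 8 * (2 * U0 + C3) / ((r : ℝ) + 1) ^ 3 :=
        div_le_div_of_nonneg_right (by nlinarith) (by positivity)
      exact h2.trans h3
  linarith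

/-- [folklore] **EXTERIOR SIZE OF `G` NEAR THE SHELL** (`r ≥ 1`): from `d0` with rate `c ≥ 0`, `|G(w+s)| ≤ 4A₀e^{c}·e^{−c(r+1)}/(r+1)²`. -/
theorem abs_G_shift_le_tail (hA0 : 0 ≤ A0) (hc : 0 ≤ c)
    (d0 : ∀ v : Pt, v ≠ 0 → |G v| ≤ A0 * Real.exp (-c * supNorm v) / (supNorm v : ℝ) ^ 2)
    (hr : 1 ≤ r) (hw : w ∈ annulus 4 r (r + 1)) (hs : (supNorm s : ℝ) ≤ 1) :
    |G (w + s)| ≤ 4 * A0 * Real.exp c * Real.exp (-c * ((r : ℝ) + 1)) / ((r : ℝ) + 1) ^ 2 := by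
  obtain ⟨hge, hne⟩ := shift_ge hr hw hs
  have h := d0 _ hne
  have hexp := exp_shift_le hr hw hs hc
  have hpow := inv_pow_shift_le hr hw hs hA0 2
  have hr1 : (1 : ℝ) ≤ (r : ℝ) := by exact_mod_cast hr
  have hsn : (0 : ℝ) < supNorm (w + s) := by linarith
  calc |G (w + s)| ≤ A0 * Real.exp (-c * supNorm (w + s)) / (supNorm (w + s) : ℝ) ^ 2 := h
    _ ≤ A0 * (Real.exp c * Real.exp (-c * ((r : ℝ) + 1))) / (supNorm (w + s) : ℝ) ^ 2 := by gcongr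
    _ = (Real.exp c * Real.exp (-c * ((r : ℝ) + 1))) * (A0 / (supNorm (w + s) : ℝ) ^ 2) := by ring
    _ ≤ (Real.exp c * Real.exp (-c * ((r : ℝ) + 1))) * (A0 * 2 ^ 2 / ((r : ℝ) + 1) ^ 2) :=
        mul_le_mul_of_nonneg_left hpow (by positivity)
    _ = 4 * A0 * Real.exp c * Real.exp (-c * ((r : ℝ) + 1)) / ((r : ℝ) + 1) ^ 2 := by ring

/-- [folklore] … the same with the exponential dropped: `|G(w+s)| ≤ 4A₀/(r+1)²`. -/
theorem abs_G_shift_le_tail' (hA0 : 0 ≤ A0) (hc : 0 ≤ c)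
    (d0 : ∀ v : Pt, v ≠ 0 → |G v| ≤ A0 * Real.exp (-c * supNorm v) / (supNorm v : ℝ) ^ 2)
    (hr : 1 ≤ r) (hw : w ∈ annulus 4 r (r + 1)) (hs : (supNorm s : ℝ) ≤ 1) :
    |G (w + s)| ≤ 4 * A0 / ((r : ℝ) + 1) ^ 2 := by
  obtain ⟨hge, hne⟩ := shift_ge hr hw hs
  have hr1 : (1 : ℝ) ≤ (r : ℝ) := by exact_mod_cast hr
  have hr0 : (0 : ℝ) < r := by linarith
  have h := (d0 _ hne).trans (SquareTable.decay_le_pow 2 hA0 hc hr0 hge)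
  exact h.trans ((SquareTable.pow_shift_le 2 hA0 hr1).trans (le_of_eq (by ring)))

/-- [folklore] **EXTERIOR SIZE OF A FIRST DIFFERENCE OF `G` NEAR THE SHELL** (`r ≥ 1`): `|G(w+s+e_ρ) − G(w+s)| ≤ 8A₁e^{c}·e^{−c(r+1)}/(r+1)³`. -/
theorem abs_dG_shift_le_tail (hA1 : 0 ≤ A1) (hc : 0 ≤ c)
    (d1 : ∀ v : Pt, v ≠ 0 → ∀ ρ : Fin 4, |G (v + unitVec ρ) - G v| ≤ A1 * Real.exp (-c * supNorm v) / (supNorm v : ℝ) ^ 3)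
    (hr : 1 ≤ r) (hw : w ∈ annulus 4 r (r + 1)) (hs : (supNorm s : ℝ) ≤ 1) (ρ : Fin 4) :
    |G (w + s + unitVec ρ) - G (w + s)| ≤ 8 * A1 * Real.exp c * Real.exp (-c * ((r : ℝ) + 1)) / ((r : ℝ) + 1) ^ 3 := by
  obtain ⟨hge, hne⟩ := shift_ge hr hw hs
  have h := d1 _ hne ρ
  have hexp := exp_shift_le hr hw hs hc
  have hpow := inv_pow_shift_le hr hw hs hA1 3
  calc |G (w + s + unitVec ρ) - G (w + s)| ≤ A1 * Real.exp (-c * supNorm (w + s)) / (supNorm (w + s) : ℝ) ^ 3 := h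
    _ ≤ A1 * (Real.exp c * Real.exp (-c * ((r : ℝ) + 1))) / (supNorm (w + s) : ℝ) ^ 3 := by gcongr
    _ = (Real.exp c * Real.exp (-c * ((r : ℝ) + 1))) * (A1 / (supNorm (w + s) : ℝ) ^ 3) := by ring
    _ ≤ (Real.exp c * Real.exp (-c * ((r : ℝ) + 1))) * (A1 * 2 ^ 3 / ((r : ℝ) + 1) ^ 3) :=
        mul_le_mul_of_nonneg_left hpow (by positivity)
    _ = 8 * A1 * Real.exp c * Real.exp (-c * ((r : ℝ) + 1)) / ((r : ℝ) + 1) ^ 3 := by ring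

/-- [folklore] … the same with the exponential dropped: `|G(w+s+e_ρ) − G(w+s)| ≤ 8A₁/(r+1)³`. -/
theorem abs_dG_shift_le_tail' (hA1 : 0 ≤ A1) (hc : 0 ≤ c)
    (d1 : ∀ v : Pt, v ≠ 0 → ∀ ρ : Fin 4, |G (v + unitVec ρ) - G v| ≤ A1 * Real.exp (-c * supNorm v) / (supNorm v : ℝ) ^ 3)
    (hr : 1 ≤ r) (hw : w ∈ annulus 4 r (r + 1)) (hs : (supNorm s : ℝ) ≤ 1) (ρ : Fin 4) :
    |G (w + s + unitVec ρ) - G (w + s)| ≤ 8 * A1 / ((r : ℝ) + 1) ^ 3 := by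
  obtain ⟨hge, hne⟩ := shift_ge hr hw hs
  have hr1 : (1 : ℝ) ≤ (r : ℝ) := by exact_mod_cast hr
  have hr0 : (0 : ℝ) < r := by linarith
  have h := (d1 _ hne ρ).trans (SquareTable.decay_le_pow 3 hA1 hc hr0 hge)
  exact h.trans ((SquareTable.pow_shift_le 3 hA1 hr1).trans (le_of_eq (by ring)))

/-- [folklore] The unit shifts used below have `‖s‖∞ ≤ 1`. -/
theorem supNorm_shifts_le_one (hμν : μ ≠ ν) :
    (supNorm (0 : Pt) : ℝ) ≤ 1 ∧ (supNorm (unitVec μ : Pt) : ℝ) ≤ 1 ∧ (supNorm (unitVec ν : Pt) : ℝ) ≤ 1 ∧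
      (supNorm (unitVec ν + unitVec μ : Pt) : ℝ) ≤ 1 ∧ (supNorm (-unitVec ν : Pt) : ℝ) ≤ 1 := by
  refine ⟨by simp [supNorm_eq_zero_iff.mpr rfl], by rw [supNorm_unitVec]; simp, by rw [supNorm_unitVec]; simp, ?_, ?_⟩
  · rw [add_comm, TwoPowerLegs.supNorm_unitVec_add hμν]; simp
  · have : supNorm (-unitVec ν : Pt) = supNorm (unitVec ν : Pt) := by
      unfold DyadicShell.supNorm; simp
    rw [this, supNorm_unitVec]; simp

end Pointwise

/-! ## §3 Lattice-sum plumbing: finite sums from window shells + exterior pointwise tails; summation by parts on `ℤ⁴` -/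

section Plumbing

/-- [folklore] `x^k·e^{−a x} ≤ k!/a^k` for `x ≥ 0`, `a > 0` (from `(ax)^k/k! ≤ e^{ax}`). -/
theorem pow_mul_exp_neg_le {x a : ℝ} (hx : 0 ≤ x) (ha : 0 < a) (k : ℕ) :
    x ^ k * Real.exp (-a * x) ≤ (Nat.factorial k : ℝ) / a ^ k := by
  have h := Real.pow_div_factorial_le_exp (a * x) (mul_nonneg ha.le hx) k
  have hfac : (0 : ℝ) < Nat.factorial k := by exact_mod_cast Nat.factorial_pos k
  have hak : (0 : ℝ) < a ^ k := pow_pos ha k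
  rw [div_le_iff₀ hfac, mul_pow] at h
  rw [show -a * x = -(a * x) by ring, Real.exp_neg, le_div_iff₀ hak]
  have hexp := Real.exp_pos (a * x)
  calc x ^ k * (Real.exp (a * x))⁻¹ * a ^ k = (a ^ k * x ^ k) / Real.exp (a * x) := by
        rw [div_eq_mul_inv]; ring
    _ ≤ (Real.exp (a * x) * Nat.factorial k) / Real.exp (a * x) := div_le_div_of_nonneg_right h hexp.le
    _ = Nat.factorial k := by field_simp

/-- [folklore] **ALL FINITE SUMS OF A NONNEGATIVE LATTICE FUNCTION FROM WINDOW SHELL SUMS + EXTERIOR POINTWISE TAILS**: if `K ≥ 0`, `K 0 = 0`,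
`Σ_{‖w‖∞=r+1} K ≤ D_w/n` for `r + 1 ≤ n` and `K(w) ≤ E/(r+1)⁴·e^{−(δ/L)(r+1)}` on the shells `r ≥ n`, then every finite sum of `K` is
`≤ D_w + 80E(1 + L/δ)/(n+1)` (boxes are cofinal; `ShellWindowInterface.window_sub_le_of_shellRows` + `WindowInterface.tail_sum_le_exp`). -/
theorem sum_le_of_shellBounds {K : Pt → ℝ} (hK : ∀ w, 0 ≤ K w) (hK0 : K 0 = 0) {n : ℕ} (hn : 1 ≤ n) {Dw E δ Lr : ℝ}
    (hDw : 0 ≤ Dw) (hE : 0 ≤ E) (hδ : 0 < δ) (hL : 0 < Lr)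
    (hwin : ∀ r : ℕ, r + 1 ≤ n → ∑ w ∈ annulus 4 r (r + 1), K w ≤ Dw / n)
    (htail : ∀ r : ℕ, n ≤ r → ∀ w ∈ annulus 4 r (r + 1), K w ≤ E / ((r : ℝ) + 1) ^ 4 * Real.exp (-(δ / Lr) * ((r : ℝ) + 1))) :
    ∀ s : Finset Pt, ∑ w ∈ s, K w ≤ Dw + 80 * E * (1 + Lr / δ) / ((n : ℝ) + 1) := by
  intro s
  obtain ⟨R, hsR, hnR⟩ := ((Filter.tendsto_atTop.1 WindowIdentification.tendsto_box_atTop s).and (eventually_ge_atTop n)).exists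
  have hwin' : |∑ w ∈ annulus 4 0 n, K w - ∑ w ∈ annulus 4 0 n, (fun _ : Pt => (0 : ℝ)) w| ≤ Dw :=
    ShellWindowInterface.window_sub_le_of_shellRows (K0 := fun _ => (0 : ℝ)) hDw hn le_rfl fun r hr => by
      have : ∑ w ∈ annulus 4 r (r + 1), |K w - 0| = ∑ w ∈ annulus 4 r (r + 1), K w :=
        Finset.sum_congr rfl fun w _ => by rw [sub_zero, abs_of_nonneg (hK w)]
      rw [this]; exact hwin r hr
  have hpn : psum K n ≤ Dw := by
    rw [WindowIdentification.psum_def]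
    have h := (le_abs_self _).trans hwin'
    simpa using h
  have htl : psum K R - psum K n ≤ 80 * E * (1 + Lr / δ) / ((n : ℝ) + 1) := by
    rw [WindowIdentification.psum_sub_psum K hnR]
    exact (le_abs_self _).trans (WindowInterface.tail_sum_le_exp hE hδ hL hnR fun r hr w hw => by
      rw [abs_of_nonneg (hK w)]; exact htail r hr w hw)
  calc ∑ w ∈ s, K w ≤ ∑ w ∈ box 4 R, K w := Finset.sum_le_sum_of_subset_of_nonneg hsR fun w _ _ => hK w
    _ = K 0 + psum K R := WindowIdentification.sum_box_eq K R
    _ = psum K n + (psum K R - psum K n) := by rw [hK0]; ring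
    _ ≤ Dw + 80 * E * (1 + Lr / δ) / ((n : ℝ) + 1) := add_le_add hpn htl

/-- [folklore] … hence summable, with the same bound on the full sum. -/
theorem summable_and_tsum_le_of_shellBounds {K : Pt → ℝ} (hK : ∀ w, 0 ≤ K w) (hK0 : K 0 = 0) {n : ℕ} (hn : 1 ≤ n) {Dw E δ Lr : ℝ}
    (hDw : 0 ≤ Dw) (hE : 0 ≤ E) (hδ : 0 < δ) (hL : 0 < Lr)
    (hwin : ∀ r : ℕ, r + 1 ≤ n → ∑ w ∈ annulus 4 r (r + 1), K w ≤ Dw / n)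
    (htail : ∀ r : ℕ, n ≤ r → ∀ w ∈ annulus 4 r (r + 1), K w ≤ E / ((r : ℝ) + 1) ^ 4 * Real.exp (-(δ / Lr) * ((r : ℝ) + 1))) :
    Summable K ∧ ∑' w, K w ≤ Dw + 80 * E * (1 + Lr / δ) / ((n : ℝ) + 1) :=
  ⟨summable_of_sum_le (fun w => hK w) (sum_le_of_shellBounds hK hK0 hn hDw hE hδ hL hwin htail),
    Real.tsum_le_of_sum_le (fun w => hK w) (sum_le_of_shellBounds hK hK0 hn hDw hE hδ hL hwin htail)⟩

/-- [folklore] **SUMMATION BY PARTS ON `ℤ⁴`, NO BOUNDARY TERMS**: for summable products, `Σ_w φ(w)(ψ(w+e) − ψ(w)) = Σ_w (φ(w−e) − φ(w))·ψ(w)`. -/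
theorem tsum_mul_shift_sub (φ ψ : Pt → ℝ) (e : Pt) (h1 : Summable fun w => φ w * ψ (w + e)) (h2 : Summable fun w => φ w * ψ w) :
    ∑' w, φ w * (ψ (w + e) - ψ w) = ∑' w, (φ (w - e) - φ w) * ψ w := by
  have key : ∑' w, φ (w - e) * ψ w = ∑' w, φ w * ψ (w + e) := by
    have h := (Equiv.subRight e).tsum_eq (fun v => φ v * ψ (v + e))
    simpa only [Equiv.subRight_apply, sub_add_cancel] using h
  have h1' : Summable fun w => φ (w - e) * ψ w := by
    have h := (Equiv.subRight e).summable_iff.mpr h1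
    simpa only [Function.comp_def, Equiv.subRight_apply, sub_add_cancel] using h
  calc ∑' w, φ w * (ψ (w + e) - ψ w) = ∑' w, (φ w * ψ (w + e) - φ w * ψ w) := by simp only [mul_sub]
    _ = ∑' w, φ w * ψ (w + e) - ∑' w, φ w * ψ w := h1.tsum_sub h2
    _ = ∑' w, φ (w - e) * ψ w - ∑' w, φ w * ψ w := by rw [key]
    _ = ∑' w, (φ (w - e) * ψ w - φ w * ψ w) := (h1'.tsum_sub h2).symm
    _ = ∑' w, (φ (w - e) - φ w) * ψ w := by simp only [sub_mul]

end Plumbing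

end Summit.QuantumFields.BalabanUV.Beta.D1BFx.SbpShellAlgebra

end
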